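import Mathlib
import HarnessLib
import Literature.MathematicalPhysics.QuantumFieldTheory.ConstructiveQFTWave0
import Summits.Ventures.LatticeQCDFlow.Scaling.LatticeEntropy
import Summits.Ventures.LatticeQCDFlow.Scaling.LatticeGibbs

/-!
# LatticeQCDFlow / Scaling — Chernoff bounds for the level sets of the Wilson action (support of the (Gβ) law)

HONEST FRAMING: exact (Metropolis-corrected) sampling algorithms for lattice gauge theory; figures of merit are
autocorrelation/cost numbers at stated couplings and volumes; no continuum-physics claim.

Venture `LatticeQCDFlow` (cell pub-lqcd), topic `Scaling`, FANOUT row 30 (lean-1) — OUR WORK; the measure-theoretic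
half of the proof of the Laplace half-mass law `Conjectures.LaplaceHalfMass` (`Scaling/LatticeLaplaceHalfMass.lean`).
For the Wilson weight `W_β = e^{-βS}·Haar^{⊗E}`, `Z_Λ(β) = W_β(univ)`, `μ_β = Z_Λ(β)⁻¹·W_β` on the torus `(ℤ/L)^d`,
continuous `ρ` with `Re tr ρ ≤ N` (so `S ≥ 0`), and a level `s`:

* `wilsonWeight_gt_le`: `W_β{S > s} ≤ e^{-βs/2}·Z_Λ(β/2)` (`e^{-βS} ≤ e^{-βs/2}·e^{-βS/2}` above the level);
* `pi_le_le`: `Haar^{⊗E}{S ≤ s} ≤ e^{βs}·Z_Λ(β)` (`1 ≤ e^{β(s-S)}` below the level);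
* `half_le_wilsonMeasure_le`: if `e^{-βs/2}·Z_Λ(β/2) ≤ Z_Λ(β)/2` then `μ_β{S ≤ s} ≥ 1/2`.

Elementary; nothing here is cited as a fact.
-/

noncomputable section

namespace Summit.Ventures.LatticeQCDFlow.Theory2.Lattice

open MeasureTheory Set Literature.MathematicalPhysics.QuantumFieldTheory

section LevelSets

variable {N : ℕ} {G : Type} [Group G] [TopologicalSpace G] [IsTopologicalGroup G]
  [CompactSpace G] [SecondCountableTopology G] [MeasurableSpace G] [BorelSpace G]
  (ρ : G →* Matrix (Fin N) (Fin N) ℂ)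

omit [SecondCountableTopology G] in
/-- The partition function as a Lebesgue integral against product Haar measure. [folklore] -/
theorem partitionFunction_eq_lintegral {d L : ℕ} [NeZero L] (β : ℝ) :
    partitionFunction (d := d) (L := L) ρ β =
      ∫⁻ U, ENNReal.ofReal (Real.exp (-β * wilsonAction ρ U))
        ∂(Measure.pi fun _ : Edge d L => haarProbability G) := by
  unfold partitionFunction wilsonWeight
  rw [withDensity_apply _ MeasurableSet.univ, Measure.restrict_univ]

omit [CompactSpace G] in
/-- The sub-level sets `{S ≤ s}` of the Wilson action are measurable (continuous `ρ`). [folklore] -/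
theorem measurableSet_action_le {d L : ℕ} [NeZero L] (hρ : Continuous (ρ : G → Matrix (Fin N) (Fin N) ℂ))
    (s : ℝ) : MeasurableSet {U : GaugeConfig d L G | wilsonAction ρ U ≤ s} :=
  (isClosed_le (continuous_wilsonAction (d := d) (L := L) ρ hρ) continuous_const).measurableSet

/-- **Chernoff above the level**: `W_β{S > s} ≤ e^{-βs/2}·Z_Λ(β/2)` for `β ≥ 0`. [folklore] -/
theorem wilsonWeight_gt_le {d L : ℕ} [NeZero L] (hρ : Continuous (ρ : G → Matrix (Fin N) (Fin N) ℂ))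
    {β : ℝ} (hβ : 0 ≤ β) (s : ℝ) :
    wilsonWeight (d := d) (L := L) ρ β {U | wilsonAction ρ U ≤ s}ᶜ ≤
      ENNReal.ofReal (Real.exp (-(β * s / 2))) * partitionFunction (d := d) (L := L) ρ (β / 2) := by
  unfold wilsonWeight
  rw [withDensity_apply _ (measurableSet_action_le ρ hρ s).compl, partitionFunction_eq_lintegral,
    ← lintegral_const_mul' _ _ ENNReal.ofReal_ne_top]
  refine (setLIntegral_mono' (measurableSet_action_le ρ hρ s).compl (fun U hU => ?_)).trans
    (setLIntegral_le_lintegral _ _)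
  rw [mem_compl_iff, mem_setOf_eq, not_le] at hU
  rw [← ENNReal.ofReal_mul (Real.exp_pos _).le, ← Real.exp_add]
  exact ENNReal.ofReal_le_ofReal (Real.exp_le_exp.2 (by nlinarith))

/-- **Chernoff below the level**: `Haar^{⊗E}{S ≤ s} ≤ e^{βs}·Z_Λ(β)` for `β ≥ 0`. [folklore] -/
theorem pi_le_le {d L : ℕ} [NeZero L] (hρ : Continuous (ρ : G → Matrix (Fin N) (Fin N) ℂ))
    {β : ℝ} (hβ : 0 ≤ β) (s : ℝ) :
    (Measure.pi fun _ : Edge d L => haarProbability G) {U | wilsonAction ρ U ≤ s} ≤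
      ENNReal.ofReal (Real.exp (β * s)) * partitionFunction (d := d) (L := L) ρ β := by
  rw [partitionFunction_eq_lintegral, ← lintegral_const_mul' _ _ ENNReal.ofReal_ne_top,
    ← lintegral_indicator_one (measurableSet_action_le ρ hρ s)]
  refine lintegral_mono fun U => ?_
  by_cases hU : U ∈ {U : GaugeConfig d L G | wilsonAction ρ U ≤ s}
  · rw [indicator_of_mem hU, Pi.one_apply, ← ENNReal.ofReal_mul (Real.exp_pos _).le, ← Real.exp_add,
      ← ENNReal.ofReal_one]
    rw [mem_setOf_eq] at hU
    exact ENNReal.ofReal_le_ofReal (Real.one_le_exp (by nlinarith))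
  · rw [indicator_of_notMem hU]
    exact bot_le

/-- **The Wilson law gives mass `≥ 1/2` to `{S ≤ s}`** as soon as `e^{-βs/2}·Z_Λ(β/2) ≤ Z_Λ(β)/2`. [folklore] -/
theorem half_le_wilsonMeasure_le {d L : ℕ} [NeZero L] (hρ : Continuous (ρ : G → Matrix (Fin N) (Fin N) ℂ))
    (htr : ∀ g, (ρ g).trace.re ≤ N) {β : ℝ} (hβ : 0 ≤ β) (s : ℝ)
    (h : Real.exp (-(β * s / 2)) * (partitionFunction (d := d) (L := L) ρ (β / 2)).toReal ≤
      (partitionFunction (d := d) (L := L) ρ β).toReal / 2) :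
    (2 : ENNReal)⁻¹ ≤ wilsonMeasure (d := d) (L := L) ρ β {U | wilsonAction ρ U ≤ s} := by
  set Z := partitionFunction (d := d) (L := L) ρ β with hZdef
  have hZ0 : Z ≠ 0 := partitionFunction_ne_zero ρ hρ β
  have hZtop : Z ≠ ⊤ := ne_top_of_le_ne_top ENNReal.one_ne_top (partitionFunction_le_one ρ htr hβ)
  have hZhtop : partitionFunction (d := d) (L := L) ρ (β / 2) ≠ ⊤ :=
    ne_top_of_le_ne_top ENNReal.one_ne_top (partitionFunction_le_one ρ htr (by positivity))
  have hZpos : 0 < Z.toReal := ENNReal.toReal_pos hZ0 hZtop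
  have hE := measurableSet_action_le (d := d) (L := L) ρ hρ s
  haveI : IsProbabilityMeasure (wilsonMeasure (d := d) (L := L) ρ β) := ⟨by
    show ((partitionFunction ρ β)⁻¹ • wilsonWeight ρ β) Set.univ = 1
    rw [Measure.smul_apply, smul_eq_mul]
    exact ENNReal.inv_mul_cancel hZ0 hZtop⟩
  -- mass of the complement
  have hc : (wilsonMeasure (d := d) (L := L) ρ β {U | wilsonAction ρ U ≤ s}ᶜ).toReal ≤ 1 / 2 := by
    have h1 : wilsonMeasure (d := d) (L := L) ρ β {U | wilsonAction ρ U ≤ s}ᶜ ≤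
        Z⁻¹ * (ENNReal.ofReal (Real.exp (-(β * s / 2))) * partitionFunction (d := d) (L := L) ρ (β / 2)) := by
      show ((partitionFunction ρ β)⁻¹ • wilsonWeight ρ β) {U | wilsonAction ρ U ≤ s}ᶜ ≤ _
      rw [Measure.smul_apply, smul_eq_mul]
      exact mul_le_mul' le_rfl (wilsonWeight_gt_le ρ hρ hβ s)
    have hfin : Z⁻¹ * (ENNReal.ofReal (Real.exp (-(β * s / 2))) *
        partitionFunction (d := d) (L := L) ρ (β / 2)) ≠ ⊤ :=
      ENNReal.mul_ne_top (ENNReal.inv_ne_top.2 hZ0) (ENNReal.mul_ne_top ENNReal.ofReal_ne_top hZhtop)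
    have h2 := ENNReal.toReal_mono hfin h1
    rw [ENNReal.toReal_mul, ENNReal.toReal_mul, ENNReal.toReal_inv, ENNReal.toReal_ofReal (Real.exp_pos _).le]
      at h2
    calc _ ≤ Z.toReal⁻¹ * (Real.exp (-(β * s / 2)) * (partitionFunction (d := d) (L := L) ρ (β / 2)).toReal) := h2
      _ ≤ Z.toReal⁻¹ * (Z.toReal / 2) := mul_le_mul_of_nonneg_left h (inv_nonneg.2 hZpos.le)
      _ = 1 / 2 := by field_simp
  -- hence the set itself has mass ≥ 1/2
  have hsum := measure_add_measure_compl (μ := wilsonMeasure (d := d) (L := L) ρ β) hE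
  rw [measure_univ] at hsum
  have hsum' : (wilsonMeasure (d := d) (L := L) ρ β {U | wilsonAction ρ U ≤ s}).toReal +
      (wilsonMeasure (d := d) (L := L) ρ β {U | wilsonAction ρ U ≤ s}ᶜ).toReal = 1 := by
    rw [← ENNReal.toReal_add (measure_ne_top _ _) (measure_ne_top _ _), hsum, ENNReal.toReal_one]
  have hge : (1 : ℝ) / 2 ≤ (wilsonMeasure (d := d) (L := L) ρ β {U | wilsonAction ρ U ≤ s}).toReal := by
    linarith
  calc (2 : ENNReal)⁻¹ = ENNReal.ofReal (1 / 2) := by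
        rw [one_div, ENNReal.ofReal_inv_of_pos two_pos, ENNReal.ofReal_ofNat]
    _ ≤ ENNReal.ofReal ((wilsonMeasure (d := d) (L := L) ρ β {U | wilsonAction ρ U ≤ s}).toReal) :=
        ENNReal.ofReal_le_ofReal hge
    _ = _ := ENNReal.ofReal_toReal (measure_ne_top _ _)

end LevelSets

end Summit.Ventures.LatticeQCDFlow.Theory2.Lattice

end
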